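import Literature.Topology.Immersions.OpenParallelizableImmersionCritical
import Literature.Topology.Immersions.HolonomicApproxCube
import Mathlib.Topology.Order.IntermediateValue
import HarnessLib

/-!
# Relative holonomic approximation data under homotheties

Topic `Literature/Topology/Immersions`; a transport lemma for the relative holonomic
approximation property `IsRelHolApprox` (`HolonomicExtensionCore.lean`) under the homotheties
`y ↦ u • y` of `ℝⁿ⁺²`, so that holonomic approximation theorems proved over a cube of fixed size
(Eliashberg–Mishachev 2002, Thm. 3.1.1, for `[-1, 1]ᵏ × 0`) yield the property at every scale
(as consumed by `HasCubeCollarApprox`).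

* `Literature.Topology.Immersions.hasCubeCollarApprox` — **`HasCubeCollarApprox n k` for `k ≤ n + 1`**,
  from the tree's holonomic approximation theorem over the unit cube
  (`HolonomicApprox.holonomic_approx_cube`, Eliashberg–Mishachev 2002, Thm. 3.1.2) through
  `exists_smooth_section_data` (smooth global data), the straight-line isotopy
  `H_s = id + s(h - id)` of the shear `h` (a shear in one coordinate whose differential stays
  invertible along the segment because `1 + ∂_k(h_k - z_k) > 0`, by connectedness) and the
  bookkeeping of `IsRelHolApprox`.
* `Literature.Topology.Immersions.hasCubeCollarApprox_of_unit` — `HasCubeCollarApprox n k` from its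
  instance with the holonomy collar normalised to `{‖y'‖∞ ≥ 1 - ρ}` (the form of cube theorems
  whose wiggle lives in `(1 - ρ/4)·[-1, 1]ᵏ`), by the homothety `u = qH / (1 - ρ)` with
  `ρ = (qB - qH) / (2 qB)`.
* `Literature.Topology.Immersions.IsRelHolApprox.of_homothety` — if the pulled-back data
  `(F₀ ∘ Dᵤ, u • F₁ ∘ Dᵤ, φ₀ ∘ Dᵤ)` over `Dᵤ⁻¹(C, B, O)` (`Dᵤ y = u • y`) have approximation data
  with accuracies `ε' ≤ min(1, u) ε`, `u δ' ≤ δ`, then conjugating the isotopy and the section by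
  `Dᵤ` gives approximation data for the original data with accuracies `ε, δ`.

## References

* Y. Eliashberg, N. Mishachev, *Introduction to the h-principle*, GSM 48 (2002), Thm. 3.1.1.
  [EliashbergMishachev2001]
-/

open Set Function Filter Metric Real
open scoped Topology ContDiff

noncomputable section

namespace Literature.Topology.Immersions

variable {n : ℕ}

/-- Local notation: the model space `ℝⁿ⁺²`. -/
local notation "𝔼₂" => EuclideanSpace ℝ (Fin (n + 2))

/-- **`IsRelHolApprox` under homotheties.** [cite: EliashbergMishachev2001, Thm. 1.3.1] -/
theorem IsRelHolApprox.of_homothety {u : ℝ} (hu : 0 < u) {C B O : Set 𝔼₂}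
    {F₀ : 𝔼₂ → 𝔼₂} {F₁ : 𝔼₂ → 𝔼₂ →L[ℝ] 𝔼₂} {φ₀ : 𝔼₂ → 𝔼₂} {ε δ ε' δ' : ℝ}
    (hε : ε' ≤ ε) (hεu : ε' ≤ u * ε) (hδ : u * δ' ≤ δ)
    {H : ℝ → 𝔼₂ → 𝔼₂} {E Ω : Set 𝔼₂} {g : 𝔼₂ → 𝔼₂}
    (h : IsRelHolApprox ((fun y => u • y) ⁻¹' C) ((fun y => u • y) ⁻¹' B) ((fun y => u • y) ⁻¹' O)
      (fun y => F₀ (u • y)) (fun y => u • F₁ (u • y)) (fun y => φ₀ (u • y)) ε' δ' H E Ω g) :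
    IsRelHolApprox C B O F₀ F₁ φ₀ ε δ (fun s y => u • H s (u⁻¹ • y)) ((fun y => u • y) '' E)
      ((fun y => u • y) '' Ω) (fun y => g (u⁻¹ • y)) := by
  have hu0 : u ≠ 0 := hu.ne'
  have hui : u⁻¹ * u = 1 := inv_mul_cancel₀ hu0
  have hiu : u * u⁻¹ = 1 := mul_inv_cancel₀ hu0
  -- the homothety and its inverse
  have hDu : ∀ y : 𝔼₂, u • (u⁻¹ • y) = y := fun y => by rw [smul_smul, hiu, one_smul]
  have hDi : ∀ y : 𝔼₂, u⁻¹ • (u • y) = y := fun y => by rw [smul_smul, hui, one_smul]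
  have himage : ∀ (X : Set 𝔼₂), (fun y => u • y) '' X = (fun y => u⁻¹ • y) ⁻¹' X := fun X => by
    ext y; constructor
    · rintro ⟨z, hz, rfl⟩; simpa [hDi] using hz
    · intro hy; exact ⟨u⁻¹ • y, hy, hDu y⟩
  have hpre : ∀ (X : Set 𝔼₂) (y : 𝔼₂), u⁻¹ • y ∈ (fun y => u • y) ⁻¹' X ↔ y ∈ X := fun X y => by
    simp [hDu]
  have hsmul_cd : ContDiff ℝ ∞ (fun y : 𝔼₂ => u⁻¹ • y) := contDiff_const_smul _
  have hsmul_cd' : ContDiff ℝ ∞ (fun y : 𝔼₂ => u • y) := contDiff_const_smul _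
  have hDsmul : ∀ y : 𝔼₂, HasFDerivAt (fun y : 𝔼₂ => u⁻¹ • y) (u⁻¹ • ContinuousLinearMap.id ℝ 𝔼₂) y :=
    fun y => (hasFDerivAt_id y).const_smul u⁻¹
  -- derivative of a conjugated map
  have hconj : ∀ {φ : 𝔼₂ → 𝔼₂} {y : 𝔼₂} (L : 𝔼₂ →L[ℝ] 𝔼₂), HasFDerivAt φ L (u⁻¹ • y) →
      HasFDerivAt (fun y => u • φ (u⁻¹ • y))
        (u • L.comp (u⁻¹ • ContinuousLinearMap.id ℝ 𝔼₂)) y := by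
    intro φ y L hL
    exact (hL.comp y (hDsmul y)).const_smul u
  -- invertibility of a conjugated invertible map
  have hinv : ∀ {M : 𝔼₂ →L[ℝ] 𝔼₂}, M.IsInvertible →
      (u • M.comp (u⁻¹ • ContinuousLinearMap.id ℝ 𝔼₂)).IsInvertible := by
    intro M ⟨L, hL⟩
    set T : 𝔼₂ →L[ℝ] 𝔼₂ := u • M.comp (u⁻¹ • ContinuousLinearMap.id ℝ 𝔼₂) with hT
    set T' : 𝔼₂ →L[ℝ] 𝔼₂ := u • (L.symm : 𝔼₂ →L[ℝ] 𝔼₂).comp (u⁻¹ • ContinuousLinearMap.id ℝ 𝔼₂)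
      with hT'
    have hLM : ∀ w, L.symm (M w) = w := fun w => by
      rw [← hL]; exact L.symm_apply_apply w
    have hML : ∀ w, M (L.symm w) = w := fun w => by
      rw [← hL]; exact L.apply_symm_apply w
    have h1 : ∀ v, T' (T v) = v := fun v => by
      simp only [hT, hT', FunLike.coe_smul, Pi.smul_apply, ContinuousLinearMap.comp_apply,
        ContinuousLinearMap.id_apply, ContinuousLinearEquiv.coe_coe, hDi, hLM, hDu]
    have h2 : ∀ v, T (T' v) = v := fun v => by
      simp only [hT, hT', FunLike.coe_smul, Pi.smul_apply, ContinuousLinearMap.comp_apply,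
        ContinuousLinearMap.id_apply, ContinuousLinearEquiv.coe_coe, hDi, hML, hDu]
    exact ⟨ContinuousLinearEquiv.equivOfInverse T T' h1 h2, rfl⟩
  refine
    { contDiff_H := fun s => ((h.contDiff_H s).comp hsmul_cd).const_smul u
      H_zero := fun y => by simp only [h.H_zero]; exact hDu y
      dist_le := fun s hs y => ?_
      isInvertible := fun s hs y => ?_
      continuous_H := ?_
      continuous_fderiv := ?_
      isOpen_ends := ?_
      boundary_subset := ?_
      ends_subset := ?_
      H_eq_self := fun s y hy => ?_
      g_eq := fun y hy => ?_
      isOpen := ?_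
      image_subset := fun y hy => ?_
      contDiff_g := h.contDiff_g.comp hsmul_cd
      approx := fun y hy => ?_ }
  · -- `dist (u • H s (u⁻¹ y)) y ≤ u δ' ≤ δ`
    have h1 := h.dist_le s hs (u⁻¹ • y)
    calc dist (u • H s (u⁻¹ • y)) y = dist (u • H s (u⁻¹ • y)) (u • (u⁻¹ • y)) := by rw [hDu]
      _ = u * dist (H s (u⁻¹ • y)) (u⁻¹ • y) := by
          rw [dist_smul₀, Real.norm_eq_abs, abs_of_pos hu]
      _ ≤ u * δ' := by gcongr
      _ ≤ δ := hδ
  · -- invertibility of the conjugated differential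
    have hd := hconj (fderiv ℝ (H s) (u⁻¹ • y))
      ((h.contDiff_H s).differentiable (by simp) _).hasFDerivAt
    rw [hd.fderiv]
    exact hinv (h.isInvertible s hs (u⁻¹ • y))
  · -- joint continuity
    have hc := h.continuous_H
    exact (hc.comp (continuous_fst.prodMk (continuous_snd.const_smul u⁻¹))).const_smul u
  · -- joint continuity of the differential
    have hc := h.continuous_fderiv
    have heq : (fun q : ℝ × 𝔼₂ => fderiv ℝ (fun y => u • H q.1 (u⁻¹ • y)) q.2) = fun q =>
        u • (fderiv ℝ (H q.1) (u⁻¹ • q.2)).comp (u⁻¹ • ContinuousLinearMap.id ℝ 𝔼₂) := by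
      funext q
      exact (hconj (fderiv ℝ (H q.1) (u⁻¹ • q.2))
        ((h.contDiff_H q.1).differentiable (by simp) _).hasFDerivAt).fderiv
    rw [heq]
    exact ((hc.comp (continuous_fst.prodMk (continuous_snd.const_smul u⁻¹))).clm_comp
      continuous_const).const_smul u
  · rw [himage]; exact h.isOpen_ends.preimage hsmul_cd.continuous
  · intro y hy
    rw [himage, mem_preimage]
    exact h.boundary_subset ((hpre B y).2 hy)
  · intro y hy
    rw [himage, mem_preimage] at hy
    exact (hpre O y).1 (h.ends_subset hy)
  · rw [himage, mem_preimage] at hy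
    show u • H s (u⁻¹ • y) = y
    rw [h.H_eq_self s _ hy]; exact hDu y
  · rw [himage, mem_preimage] at hy
    show g (u⁻¹ • y) = φ₀ y
    rw [h.g_eq _ hy]; simp only [hDu]
  · rw [himage]; exact h.isOpen.preimage hsmul_cd.continuous
  · rw [himage, mem_preimage]
    show u⁻¹ • (u • H 1 (u⁻¹ • y)) ∈ Ω
    rw [hDi]
    exact h.image_subset _ ((hpre C y).2 hy)
  · rw [himage, mem_preimage] at hy
    obtain ⟨h0, h1⟩ := h.approx _ hy
    refine ⟨?_, ?_⟩
    · simp only [hDu] at h0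
      exact lt_of_lt_of_le h0 hε
    · -- `D(g ∘ Dᵤ⁻¹) y - F₁ y = u⁻¹ • (Dg - F₁ᵘ)(u⁻¹ y)`
      have hd : HasFDerivAt (fun y => g (u⁻¹ • y))
          ((fderiv ℝ g (u⁻¹ • y)).comp (u⁻¹ • ContinuousLinearMap.id ℝ 𝔼₂)) y :=
        (h.contDiff_g.differentiable (by simp) _).hasFDerivAt.comp y (hDsmul y)
      rw [hd.fderiv]
      have heq : (fderiv ℝ g (u⁻¹ • y)).comp (u⁻¹ • ContinuousLinearMap.id ℝ 𝔼₂) - F₁ y =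
          u⁻¹ • (fderiv ℝ g (u⁻¹ • y) - u • F₁ (u • (u⁻¹ • y))) := by
        rw [hDu]; ext v; simp [smul_sub, smul_smul, hui]
      rw [heq, norm_smul, Real.norm_eq_abs, abs_of_pos (inv_pos.2 hu)]
      calc u⁻¹ * ‖fderiv ℝ g (u⁻¹ • y) - u • F₁ (u • (u⁻¹ • y))‖ < u⁻¹ * ε' :=
            mul_lt_mul_of_pos_left h1 (inv_pos.2 hu)
        _ ≤ u⁻¹ * (u * ε) := by gcongr
        _ = ε := by rw [← mul_assoc, hui, one_mul]


/-! ### Cubes and collars under homotheties -/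

section Scaling

variable {m : ℕ}

/-- Preimage of `planeCube` under a homothety. [folklore] -/
theorem preimage_smul_planeCube {u : ℝ} (hu : 0 < u) (k : ℕ) (q : ℝ) :
    (fun y : EuclideanSpace ℝ (Fin m) => u • y) ⁻¹' planeCube k q = planeCube k (q / u) := by
  ext y
  simp only [mem_preimage, mem_planeCube, PiLp.smul_apply, smul_eq_mul, abs_mul, abs_of_pos hu,
    mul_eq_zero, hu.ne', false_or, le_div_iff₀ hu]
  constructor
  · rintro ⟨h1, h2⟩; exact ⟨fun i hi => by have := h1 i hi; linarith [mul_comm u |y i|], h2⟩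
  · rintro ⟨h1, h2⟩; exact ⟨fun i hi => by have := h1 i hi; linarith [mul_comm u |y i|], h2⟩

/-- Preimage of `collarPart` under a homothety. [folklore] -/
theorem preimage_smul_collarPart {u : ℝ} (hu : 0 < u) (k : ℕ) (q : ℝ) :
    (fun y : EuclideanSpace ℝ (Fin m) => u • y) ⁻¹' collarPart k q = collarPart k (q / u) := by
  ext y
  simp only [mem_preimage, mem_collarPart, PiLp.smul_apply, smul_eq_mul, abs_mul, abs_of_pos hu,
    div_le_iff₀ hu]
  constructor
  · rintro ⟨i, hi, h⟩; exact ⟨i, hi, by linarith [mul_comm u |y i|]⟩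
  · rintro ⟨i, hi, h⟩; exact ⟨i, hi, by linarith [mul_comm u |y i|]⟩

end Scaling

/-! ### Normalising the holonomy collar -/

/-- **`HasCubeCollarApprox` from the normalised form.** Suppose that for all `0 < ρ < 1`,
`1 - ρ/4 < Q_B < Q_C` the pair (`[-Q_C, Q_C]ᵏ × 0`, its part of sup-norm `≥ Q_B`) has the
relative holonomic approximation property for sections holonomic on open sets containing the
part of the cube of sup-norm `≥ 1 - ρ`. Then `HasCubeCollarApprox n k`. [cite: EliashbergMishachev2001, Thm. 1.3.1] -/
theorem hasCubeCollarApprox_of_unit {k : ℕ}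
    (h : ∀ (ρ QB QC : ℝ), 0 < ρ → ρ < 1 → 1 - ρ / 4 < QB → QB < QC →
      ∀ (F₀ : 𝔼₂ → 𝔼₂) (F₁ : 𝔼₂ → 𝔼₂ →L[ℝ] 𝔼₂) (φ₀ : 𝔼₂ → 𝔼₂) (O' : Set 𝔼₂) (ε δ : ℝ),
        Continuous F₀ → Continuous F₁ → ContDiff ℝ ∞ φ₀ → IsOpen O' →
        planeCube k QC ∩ collarPart k (1 - ρ) ⊆ O' →
        (∀ x ∈ O', φ₀ x = F₀ x ∧ fderiv ℝ φ₀ x = F₁ x) → 0 < ε → 0 < δ →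
        ∃ (H : ℝ → 𝔼₂ → 𝔼₂) (E Ω : Set 𝔼₂) (g : 𝔼₂ → 𝔼₂),
          IsRelHolApprox (planeCube k QC) (planeCube k QC ∩ collarPart k QB) O' F₀ F₁ φ₀ ε δ H E Ω g) :
    HasCubeCollarApprox n k := by
  refine ⟨fun qH qB qC hqH hHB hBC F₀ F₁ φ₀ O' ε δ h₀ h₁ hφ₀ hO' hsub hhol hε hδ => ?_⟩
  have hqB : 0 < qB := hqH.trans hHB
  -- the margin `ρ` and the unit `u`
  set ρ : ℝ := (qB - qH) / (2 * qB) with hρ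
  have hρ0 : 0 < ρ := by rw [hρ]; exact div_pos (by linarith) (by linarith)
  have hρ1 : ρ < 1 := by
    rw [hρ, div_lt_one (by linarith)]; linarith
  set u : ℝ := qH / (1 - ρ) with hu
  have hu0 : 0 < u := div_pos hqH (by linarith)
  have h1ρ : (1 - ρ) ≠ 0 := ne_of_gt (by linarith)
  have huρ : u * (1 - ρ) = qH := by rw [hu, div_mul_cancel₀ _ h1ρ]
  set QB : ℝ := qB / u with hQB
  set QC : ℝ := qC / u with hQC
  have hQB' : 1 - ρ / 4 < QB := by
    rw [hQB, lt_div_iff₀ hu0]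
    -- `(1 - ρ/4) u < qB`, i.e. `qH (1 - ρ/4) < qB (1 - ρ)`
    have h1 : (1 - ρ / 4) * u = qH * (1 - ρ / 4) / (1 - ρ) := by rw [hu]; ring
    rw [h1, div_lt_iff₀ (by linarith)]
    have h2 : qB * (1 - ρ) = (qB + qH) / 2 := by rw [hρ]; field_simp; ring
    rw [h2]
    have h3 : qH * (1 - ρ / 4) = qH - qH * (qB - qH) / (8 * qB) := by rw [hρ]; field_simp; ring
    rw [h3]
    have h4 : 0 < qH * (qB - qH) / (8 * qB) := by positivity
    linarith
  have hQBC : QB < QC := by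
    rw [hQB, hQC]; exact div_lt_div_of_pos_right hBC hu0
  -- pulled-back data
  set F₀' : 𝔼₂ → 𝔼₂ := fun y => F₀ (u • y) with hF₀'
  set F₁' : 𝔼₂ → 𝔼₂ →L[ℝ] 𝔼₂ := fun y => u • F₁ (u • y) with hF₁'
  set φ₀' : 𝔼₂ → 𝔼₂ := fun y => φ₀ (u • y) with hφ₀'
  set O'' : Set 𝔼₂ := (fun y => u • y) ⁻¹' O' with hO''
  have hsm : Continuous fun y : 𝔼₂ => u • y := continuous_const_smul u
  have h₀' : Continuous F₀' := h₀.comp hsm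
  have h₁' : Continuous F₁' := (h₁.comp hsm).const_smul u
  have hφ₀s : ContDiff ℝ ∞ φ₀' := hφ₀.comp (contDiff_const_smul u)
  have hO''open : IsOpen O'' := hO'.preimage hsm
  have hhol' : ∀ x ∈ O'', φ₀' x = F₀' x ∧ fderiv ℝ φ₀' x = F₁' x := by
    intro x hx
    obtain ⟨h0, h1⟩ := hhol (u • x) hx
    refine ⟨by simp only [hφ₀', hF₀', h0], ?_⟩
    have hd : HasFDerivAt φ₀' ((fderiv ℝ φ₀ (u • x)).comp (u • ContinuousLinearMap.id ℝ 𝔼₂)) x :=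
      (hφ₀.differentiable (by simp) _).hasFDerivAt.comp x ((hasFDerivAt_id x).const_smul u)
    rw [hd.fderiv, h1]
    ext v; simp [hF₁']
  have hsub' : planeCube k QC ∩ collarPart k (1 - ρ) ⊆ O'' := by
    intro y hy
    have h1 : u • y ∈ planeCube k qC ∩ collarPart k qH := by
      constructor
      · have := (preimage_smul_planeCube hu0 k qC).symm ▸ (show y ∈ planeCube k (qC / u) from hy.1)
        exact this
      · have h2 : y ∈ collarPart k (qH / u) := by
          rw [show qH / u = 1 - ρ by rw [hu, div_div_cancel₀ hqH.ne'] ]; exact hy.2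
        have := (preimage_smul_collarPart hu0 k qH).symm ▸ h2
        exact this
    exact hsub h1
  -- accuracies
  set ε' : ℝ := ε * min 1 u with hε'
  have hε'pos : 0 < ε' := mul_pos hε (lt_min one_pos hu0)
  have hε'le : ε' ≤ ε := by
    rw [hε']; nlinarith [min_le_left (1 : ℝ) u, hε]
  have hε'u : ε' ≤ u * ε := by
    rw [hε']; nlinarith [min_le_right (1 : ℝ) u, hε]
  have hδ' : 0 < δ / u := div_pos hδ hu0
  obtain ⟨H, E, Ω, g, happ⟩ := h ρ QB QC hρ0 hρ1 hQB' hQBC F₀' F₁' φ₀' O'' ε' (δ / u)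
    h₀' h₁' hφ₀s hO''open hsub' hhol' hε'pos hδ'
  have hδu : u * (δ / u) ≤ δ := by rw [mul_div_cancel₀ _ hu0.ne']
  rw [hQC, hQB, ← preimage_smul_planeCube hu0 k qC, ← preimage_smul_collarPart hu0 k qB,
    ← Set.preimage_inter] at happ
  exact ⟨_, _, _, _, IsRelHolApprox.of_homothety hu0 hε'le hε'u hδu happ⟩


/-! ### The nearest point of the cube: clamping coordinates -/

section Clamp

variable {m : ℕ}

/-- Clamping a real number to `[-Q, Q]`. [folklore] -/
def clamp1 (Q t : ℝ) : ℝ := max (-Q) (min Q t)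

/-- `clamp1 Q t ∈ [-Q, Q]` for `0 ≤ Q`. [folklore] -/
theorem abs_clamp1_le {Q : ℝ} (hQ : 0 ≤ Q) (t : ℝ) : |clamp1 Q t| ≤ Q := by
  unfold clamp1
  rw [abs_le]; constructor
  · exact le_max_left _ _
  · exact max_le (by linarith) (min_le_left _ _)

/-- `|clamp1 Q t| = min |t| Q` for `0 ≤ Q`. [folklore] -/
theorem abs_clamp1 {Q : ℝ} (hQ : 0 ≤ Q) (t : ℝ) : |clamp1 Q t| = min |t| Q := by
  unfold clamp1
  rcases le_total t Q with h1 | h1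
  · rw [min_eq_right h1]
    rcases le_total (-Q) t with h2 | h2
    · rw [max_eq_right h2, min_eq_left (abs_le.2 ⟨h2, h1⟩)]
    · rw [max_eq_left h2, abs_neg, abs_of_nonneg hQ, min_eq_right]
      rw [abs_of_nonpos (by linarith)]; linarith
  · rw [min_eq_left h1, max_eq_right (by linarith), abs_of_nonneg hQ, min_eq_right]
    rw [abs_of_nonneg (by linarith)]; exact h1

/-- The clamp is the nearest point of `[-Q, Q]`. [folklore] -/
theorem abs_sub_clamp1_le {Q t c : ℝ} (hc : |c| ≤ Q) : |t - clamp1 Q t| ≤ |t - c| := by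
  have hc' := abs_le.1 hc
  unfold clamp1
  rcases le_total t Q with h1 | h1
  · rw [min_eq_right h1]
    rcases le_total (-Q) t with h2 | h2
    · rw [max_eq_right h2, sub_self, abs_zero]; exact abs_nonneg _
    · rw [max_eq_left h2, abs_of_nonpos (by linarith), abs_of_nonpos (by linarith)]; linarith
  · rw [min_eq_left h1, max_eq_right (by linarith [abs_nonneg c]), abs_of_nonneg (by linarith),
      abs_of_nonneg (by linarith)]
    linarith

/-- Clamping the first `k` coordinates to `[-Q, Q]` and zeroing the others. [folklore] -/
def clampCube (k : ℕ) (Q : ℝ) (z : EuclideanSpace ℝ (Fin m)) : EuclideanSpace ℝ (Fin m) :=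
  WithLp.toLp 2 fun i => if i.val < k then clamp1 Q (z i) else 0

/-- Coordinates of `clampCube`. [folklore] -/
@[simp] theorem clampCube_apply (k : ℕ) (Q : ℝ) (z : EuclideanSpace ℝ (Fin m)) (i : Fin m) :
    clampCube k Q z i = if i.val < k then clamp1 Q (z i) else 0 := rfl

/-- `clampCube k Q z ∈ planeCube k Q` (`0 ≤ Q`). [folklore] -/
theorem clampCube_mem_planeCube {k : ℕ} {Q : ℝ} (hQ : 0 ≤ Q) (z : EuclideanSpace ℝ (Fin m)) :
    clampCube k Q z ∈ planeCube k Q := by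
  refine ⟨fun i hi => ?_, fun i hi => ?_⟩
  · simp [clampCube_apply, hi, abs_clamp1_le hQ]
  · simp [clampCube_apply, not_lt.2 hi]

/-- **The clamp is the nearest point of the cube** to a point of the coordinate `k`-plane.
[folklore] -/
theorem dist_clampCube_le {k : ℕ} {Q : ℝ} {z c : EuclideanSpace ℝ (Fin m)}
    (hz : ∀ i : Fin m, k ≤ i.val → z i = 0) (hc : c ∈ planeCube k Q) :
    dist z (clampCube k Q z) ≤ dist z c := by
  rw [EuclideanSpace.dist_eq, EuclideanSpace.dist_eq]
  refine Real.sqrt_le_sqrt (Finset.sum_le_sum fun i _ => ?_)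
  have h : dist (z i) (clampCube k Q z i) ≤ dist (z i) (c i) := by
    rw [Real.dist_eq, Real.dist_eq, clampCube_apply]
    by_cases hi : i.val < k
    · simp only [hi, if_true]
      exact abs_sub_clamp1_le (hc.1 i hi)
    · simp only [hi, if_false]
      rw [hz i (not_lt.1 hi), hc.2 i (not_lt.1 hi)]
  exact pow_le_pow_left₀ dist_nonneg h 2

/-- **A plane point outside the `q`-cube and within `r` of the `Q`-cube is within `r` of the
collar part of the `Q`-cube** (`q ≤ Q`): the nearest point of the cube lies in the collar.
[folklore] -/
theorem mem_thickening_planeCube_inter_collarPart {k : ℕ} {q Q r : ℝ} (hq : 0 ≤ q) (hqQ : q ≤ Q)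
    {z : EuclideanSpace ℝ (Fin m)} (hz : ∀ i : Fin m, k ≤ i.val → z i = 0)
    (hzq : z ∈ collarPart k q) (hzr : z ∈ thickening r (planeCube k Q)) :
    z ∈ thickening r (planeCube k Q ∩ collarPart k q) := by
  rw [mem_thickening_iff] at hzr ⊢
  obtain ⟨c, hc, hzc⟩ := hzr
  have hQ : 0 ≤ Q := hq.trans hqQ
  refine ⟨clampCube k Q z, ⟨clampCube_mem_planeCube hQ z, ?_⟩, (dist_clampCube_le hz hc).trans_lt hzc⟩
  obtain ⟨i, hi, hzi⟩ := hzq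
  refine ⟨i, hi, ?_⟩
  rw [clampCube_apply, if_pos hi, abs_clamp1 hQ]
  exact le_min hzi hqQ

end Clamp


/-! ### Smooth section data from a section holonomic near the collar -/

/-- **Smooth global section data for an explicit cube construction.** Given a `1`-jet section
`(F₀, F₁)` over `ℝⁿ⁺²` (continuous), holonomic (`= J¹φ₀`, `φ₀` of class `C^∞`) on an open set
`O'` containing the collar part `{‖y'‖∞ ≥ 1 - ρ}` of the cube `[-Q_C, Q_C]ᵏ × 0` (`1 - ρ ≤ Q_C`),
and `ε > 0`, there are `C^∞` data `(f, A)` with `‖f - F₀‖ < ε` everywhere, `‖A - F₁‖ < ε` on a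
closed tube about the cube, `f = φ₀` on an open tube about the collar part (inside `O'`), and
`Df = A` at EVERY point of the coordinate `k`-plane of sup-norm `≥ 1 - ρ` (the global form of the
"holonomic near `∂K`" hypothesis of explicit constructions, Eliashberg–Mishachev 2002, 3.1.2):
`f = φ₀ + m` with `m` a smoothing of `F₀ - φ₀` vanishing near the collar, and
`A = χ A₁ + (1 - χ) Df` with `A₁` a smoothing of `F₁` equal to `Dφ₀` near the collar and `χ` a
cut-off equal to `1` near the cube (`exists_contDiff_approx_eqOn`, clamping). [cite: EliashbergMishachev2001, Thm. 1.3.1] -/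
theorem exists_smooth_section_data {k : ℕ} {ρ QC : ℝ} (hρ1 : ρ < 1) (hQC : 1 - ρ ≤ QC)
    {F₀ : 𝔼₂ → 𝔼₂} {F₁ : 𝔼₂ → 𝔼₂ →L[ℝ] 𝔼₂} {φ₀ : 𝔼₂ → 𝔼₂} {O' : Set 𝔼₂}
    (h₀ : Continuous F₀) (h₁ : Continuous F₁) (hφ₀ : ContDiff ℝ ∞ φ₀) (hO' : IsOpen O')
    (hsub : planeCube k QC ∩ collarPart k (1 - ρ) ⊆ O')
    (hhol : ∀ x ∈ O', φ₀ x = F₀ x ∧ fderiv ℝ φ₀ x = F₁ x) {ε : ℝ} (hε : 0 < ε) :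
    ∃ (f : 𝔼₂ → 𝔼₂) (A : 𝔼₂ → 𝔼₂ →L[ℝ] 𝔼₂) (r : ℝ), 0 < r ∧ ContDiff ℝ ∞ f ∧ ContDiff ℝ ∞ A ∧
      (∀ x, ‖f x - F₀ x‖ < ε) ∧
      (∀ x ∈ cthickening r (planeCube k QC), ‖A x - F₁ x‖ < ε) ∧
      thickening (8 * r) (planeCube k QC ∩ collarPart k (1 - ρ)) ⊆ O' ∧
      (∀ x ∈ thickening (8 * r) (planeCube k QC ∩ collarPart k (1 - ρ)), f x = φ₀ x) ∧
      ∀ z : 𝔼₂, (∀ l : Fin (n + 2), k ≤ l.val → z l = 0) → z ∈ collarPart k (1 - ρ) →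
        fderiv ℝ f z = A z := by
  set Cq : Set 𝔼₂ := planeCube k QC with hCq
  set Zq : Set 𝔼₂ := planeCube k QC ∩ collarPart k (1 - ρ) with hZq
  have hZc : IsCompact Zq := (isCompact_planeCube k QC).inter_right (isClosed_collarPart k _)
  obtain ⟨r', hr', hS₁O⟩ := hZc.exists_cthickening_subset_open hO' hsub
  set S₁ : Set 𝔼₂ := cthickening r' Zq with hS₁
  have hS₁c : IsClosed S₁ := isClosed_cthickening
  -- smoothing of `F₁`, exact on `S₁`
  have hDφ₀ : ContDiff ℝ ∞ (fderiv ℝ φ₀) := hφ₀.fderiv_right (by simp)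
  obtain ⟨A₁, hA₁s, hA₁ε, hA₁S⟩ := exists_contDiff_approx_eqOn h₁ hDφ₀ hO' hS₁c hS₁O
    (fun x hx => (hhol x hx).2) hε
  -- smoothing of `F₀ - φ₀`, vanishing on `S₁`
  obtain ⟨mm, hms, hmε, hmS⟩ := exists_contDiff_approx_eqOn (F₁ := fun x => F₀ x - φ₀ x)
    (G := fun _ => (0 : 𝔼₂)) (h₀.sub hφ₀.continuous) contDiff_const hO' hS₁c hS₁O
    (fun x hx => by simp [(hhol x hx).1]) hε
  set f : 𝔼₂ → 𝔼₂ := fun x => φ₀ x + mm x with hf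
  have hfs : ContDiff ℝ ∞ f := hφ₀.add hms
  have hfS : ∀ x ∈ S₁, f x = φ₀ x := fun x hx => by simp [hf, hmS x hx]
  -- the cut-off `χ` near the cube
  set r : ℝ := r' / 8 with hr
  have hrpos : 0 < r := by positivity
  obtain ⟨χ, hχs, hχ0, hχ1, hχ01⟩ := exists_contDiff_zero_one_of_isClosed (n := n)
    (isOpen_thickening (δ := 2 * r) (E := Cq)).isClosed_compl (isClosed_cthickening (δ := r) (E := Cq))
    (disjoint_compl_left_iff_subset.2
      (cthickening_subset_thickening' (by positivity) (by rw [hr]; linarith) Cq))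
  set A : 𝔼₂ → 𝔼₂ →L[ℝ] 𝔼₂ := fun x => χ x • A₁ x + (1 - χ x) • fderiv ℝ f x with hA
  have hDf : ContDiff ℝ ∞ (fderiv ℝ f) := hfs.fderiv_right (by simp)
  have hAs : ContDiff ℝ ∞ A :=
    (hχs.smul hA₁s).add ((contDiff_const.sub hχs).smul hDf)
  refine ⟨f, A, r, hrpos, hfs, hAs, fun x => ?_, fun x hx => ?_, ?_, fun x hx => ?_, fun z hz hzq => ?_⟩
  · -- `‖f - F₀‖ < ε`
    have := hmε x
    simp only [hf]
    calc ‖φ₀ x + mm x - F₀ x‖ = ‖mm x - (F₀ x - φ₀ x)‖ := by congr 1; abel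
      _ < ε := this
  · -- `‖A - F₁‖ < ε` on the closed `r`-tube of the cube (`χ = 1`)
    have h1 : χ x = 1 := hχ1 hx
    simp only [hA, h1, one_smul, sub_self]
    rw [zero_smul_clm, add_zero]
    exact hA₁ε x
  · -- the open tube about the collar lies in `O'`
    rw [show 8 * r = r' by rw [hr]; ring]
    exact (thickening_subset_cthickening r' Zq).trans hS₁O
  · rw [show 8 * r = r' by rw [hr]; ring] at hx
    exact hfS x (thickening_subset_cthickening r' Zq hx)
  · -- `Df = A` at every plane point of sup-norm `≥ 1 - ρ`
    by_cases hχz : χ z = 0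
    · simp only [hA, hχz, sub_zero, one_smul]
      rw [zero_smul_clm, zero_add]
    · -- `z` is near the cube, hence near its collar part, where `f = φ₀` and `A₁ = Dφ₀`
      have hz2 : z ∈ thickening (2 * r) Cq := by
        by_contra h'; exact hχz (hχ0 h')
      have hzZ : z ∈ thickening (2 * r) Zq :=
        mem_thickening_planeCube_inter_collarPart (by linarith) hQC hz hzq hz2
      have h2r : 2 * r < r' := by rw [hr]; linarith
      have hzS : z ∈ S₁ := (thickening_subset_cthickening_of_le h2r.le Zq) hzZ
      -- `f = φ₀` near `z`
      have hfev : f =ᶠ[𝓝 z] φ₀ := by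
        have hopen : IsOpen (thickening r' Zq) := isOpen_thickening
        filter_upwards [hopen.mem_nhds (thickening_mono h2r.le Zq hzZ)] with w hw
        exact hfS w (thickening_subset_cthickening r' Zq hw)
      have hDfz : fderiv ℝ f z = fderiv ℝ φ₀ z := hfev.fderiv_eq
      simp only [hA, hA₁S z hzS, hDfz]
      symm
      calc χ z • fderiv ℝ φ₀ z + (1 - χ z) • fderiv ℝ φ₀ z
          = (χ z + (1 - χ z)) • fderiv ℝ φ₀ z := (add_smul _ _ _).symm
        _ = fderiv ℝ φ₀ z := by rw [add_sub_cancel, one_smul]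


/-! ### Rank-one perturbations of the identity -/

section RankOne

variable {V : Type*} [NormedAddCommGroup V] [NormedSpace ℝ V]

/-- **Sherman–Morrison for a rank-one perturbation of the identity**: `id + c (ℓ ⊗ v)` is
invertible as soon as `1 + c ℓ(v) ≠ 0`, with inverse `id - (c / (1 + c ℓ v)) (ℓ ⊗ v)`. [folklore] -/
theorem isInvertible_id_add_smul_rankOne (ℓ : V →L[ℝ] ℝ) (v : V) {c : ℝ} (hc : 1 + c * ℓ v ≠ 0) :
    (ContinuousLinearMap.id ℝ V +
      c • ((ContinuousLinearMap.smulRight (1 : ℝ →L[ℝ] ℝ) v).comp ℓ)).IsInvertible := by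
  set Rv : V →L[ℝ] V := (ContinuousLinearMap.smulRight (1 : ℝ →L[ℝ] ℝ) v).comp ℓ with hRv
  have hRv_apply : ∀ w, Rv w = ℓ w • v := fun w => by
    simp [hRv, ContinuousLinearMap.smulRight_apply]
  set a : ℝ := c / (1 + c * ℓ v) with ha
  set T : V →L[ℝ] V := ContinuousLinearMap.id ℝ V + c • Rv with hT
  set T' : V →L[ℝ] V := ContinuousLinearMap.id ℝ V - a • Rv with hT'
  have hT_apply : ∀ w, T w = w + (c * ℓ w) • v := fun w => by
    simp only [hT, add_apply, ContinuousLinearMap.id_apply,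
      FunLike.coe_smul, Pi.smul_apply, hRv_apply, smul_smul]
  have hT'_apply : ∀ w, T' w = w - (a * ℓ w) • v := fun w => by
    simp only [hT', sub_apply, ContinuousLinearMap.id_apply,
      FunLike.coe_smul, Pi.smul_apply, hRv_apply, smul_smul]
  have hkey : c - a - a * c * ℓ v = 0 := by
    rw [ha]; field_simp; ring
  have h1 : ∀ w, T' (T w) = w := fun w => by
    rw [hT_apply, hT'_apply, map_add, map_smul, smul_eq_mul]
    have : (c * ℓ w - a * (ℓ w + c * ℓ w * ℓ v)) = (c - a - a * c * ℓ v) * ℓ w := by ring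
    calc w + (c * ℓ w) • v - (a * (ℓ w + c * ℓ w * ℓ v)) • v
        = w + (c * ℓ w - a * (ℓ w + c * ℓ w * ℓ v)) • v := by module
      _ = w := by rw [this, hkey, zero_mul, zero_smul, add_zero]
  have h2 : ∀ w, T (T' w) = w := fun w => by
    rw [hT'_apply, hT_apply, map_sub, map_smul, smul_eq_mul]
    have : (-(a * ℓ w) + c * (ℓ w - a * ℓ w * ℓ v)) = (c - a - a * c * ℓ v) * ℓ w := by ring
    calc w - (a * ℓ w) • v + (c * (ℓ w - a * ℓ w * ℓ v)) • v
        = w + (-(a * ℓ w) + c * (ℓ w - a * ℓ w * ℓ v)) • v := by module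
      _ = w := by rw [this, hkey, zero_mul, zero_smul, add_zero]
  exact ⟨ContinuousLinearEquiv.equivOfInverse T T' h1 h2, rfl⟩

end RankOne

/-! ### `HasCubeCollarApprox` from the cube theorem -/

open Classical in
/-- **Holonomic approximation over cubes relative to a collar, in the form consumed by the
handle steps**: `HasCubeCollarApprox n k` for `k ≤ n + 1`, from the tree's
`HolonomicApprox.holonomic_approx_cube` (Eliashberg–Mishachev 2002, Thm. 3.1.2).
[cite: EliashbergMishachev2001, Thm. 1.3.1] -/
theorem hasCubeCollarApprox {k : ℕ} (hkn : k ≤ n + 1) : HasCubeCollarApprox n k := by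
  refine hasCubeCollarApprox_of_unit fun ρ QB QC hρ hρ1 hQB hQBC F₀ F₁ φ₀ O' ε δ h₀ h₁ hφ₀ hO'
    hsub hhol hε hδ => ?_
  have hk : k < n + 2 := by omega
  have hQC : 1 - ρ ≤ QC := by linarith
  -- ### smooth global data
  obtain ⟨f, A, r, hr, hf, hA, hfF₀, hAF₁, hT₈O, hfφ₀, hol⟩ :=
    exists_smooth_section_data (k := k) hρ1 hQC h₀ h₁ hφ₀ hO' hsub hhol (ε := ε / 3) (by positivity)
  have hT₈open : IsOpen (thickening (8 * r) (planeCube (m := n + 2) k QC ∩ collarPart k (1 - ρ))) :=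
    isOpen_thickening
  -- ### the cube theorem
  set ε₂ : ℝ := min (ε / 3) (min δ (r / 2)) with hε₂
  have hε₂pos : 0 < ε₂ := lt_min (by positivity) (lt_min hδ (by positivity))
  have hε₂ε : ε₂ ≤ ε / 3 := min_le_left _ _
  have hε₂δ : ε₂ ≤ δ := (min_le_right _ _).trans (min_le_left _ _)
  have hε₂r : ε₂ ≤ r / 2 := (min_le_right _ _).trans (min_le_right _ _)
  obtain ⟨g, h, W, hg, hh, hW, hKW, hgf, hDgA, hg_collar, -, -, hh_collar, hh_normal, hcoord,
    -, hhdist, hhinv⟩ :=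
    HolonomicApprox.holonomic_approx_cube (n := n + 2) (G := 𝔼₂) hk hf hA hρ hρ1 hol hε₂pos
  -- ### the shear structure of `h`
  set κ : Fin (n + 2) := ⟨k, hk⟩ with hκ
  set ek : 𝔼₂ := EuclideanSpace.single κ (1 : ℝ) with hek
  have hek_norm : ‖ek‖ = 1 := by simp [hek]
  have hek_ne : ek ≠ 0 := fun h0 => by
    have := congrArg (fun v : 𝔼₂ => v κ) h0
    simp [hek] at this
  set θ : 𝔼₂ → ℝ := fun z => h z κ - z κ with hθ
  have hθs : ContDiff ℝ ∞ θ :=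
    ((EuclideanSpace.proj (𝕜 := ℝ) κ : 𝔼₂ →L[ℝ] ℝ).contDiff.comp hh).sub
      (EuclideanSpace.proj (𝕜 := ℝ) κ : 𝔼₂ →L[ℝ] ℝ).contDiff
  have hhθ : ∀ z, h z = z + θ z • ek := by
    intro z
    ext l
    by_cases hl : l = κ
    · subst hl
      simp [hθ, hek]
    · have hl' : l.val ≠ k := fun h' => hl (Fin.ext h')
      simp [hek, hcoord z l hl', hl]
  have hθabs : ∀ z, |θ z| ≤ ε₂ := fun z => by
    have h1 := hhdist z
    rw [hhθ z, add_sub_cancel_left, norm_smul, Real.norm_eq_abs, hek_norm, mul_one] at h1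
    exact h1
  -- ### the rank-one derivative structure
  set R : 𝔼₂ → 𝔼₂ →L[ℝ] 𝔼₂ := fun z =>
    (ContinuousLinearMap.smulRight (1 : ℝ →L[ℝ] ℝ) ek).comp (fderiv ℝ θ z) with hR
  have hR_apply : ∀ z v, R z v = (fderiv ℝ θ z v) • ek := fun z v => by
    simp [hR, ContinuousLinearMap.smulRight_apply]
  have hRc : Continuous R := (continuous_const.clm_comp (hθs.continuous_fderiv (by simp)))
  set H : ℝ → 𝔼₂ → 𝔼₂ := fun s z => z + s • (θ z • ek) with hH
  have hHd : ∀ s z, HasFDerivAt (H s) (ContinuousLinearMap.id ℝ 𝔼₂ + s • R z) z := by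
    intro s z
    have hθd : HasFDerivAt θ (fderiv ℝ θ z) z := (hθs.differentiable (by simp) z).hasFDerivAt
    have h1 : HasFDerivAt (fun z => θ z • ek) ((fderiv ℝ θ z).smulRight ek) z := hθd.smul_const ek
    have h2 := ((hasFDerivAt_id z).add (h1.const_smul s))
    exact h2.congr_fderiv rfl
  have hH1 : H 1 = h := by
    funext z; simp only [hH, one_smul]; exact (hhθ z).symm
  have hDh : ∀ z, fderiv ℝ h z = ContinuousLinearMap.id ℝ 𝔼₂ + (1 : ℝ) • R z := fun z => by
    rw [← hH1]; exact (hHd 1 z).fderiv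
  -- ### `1 + ∂_κ θ > 0` everywhere
  set P : 𝔼₂ → ℝ := fun z => 1 + fderiv ℝ θ z ek with hP
  have hPc : Continuous P :=
    continuous_const.add ((hθs.continuous_fderiv (by simp)).clm_apply continuous_const)
  have hPne : ∀ z, P z ≠ 0 := by
    intro z hz
    obtain ⟨L, hL⟩ := hhinv z
    have h1 : fderiv ℝ h z ek = P z • ek := by
      rw [hDh z]
      simp only [add_apply, ContinuousLinearMap.id_apply, one_smul, hR_apply, hP]
      rw [add_smul, one_smul]
    rw [hz, zero_smul, ← hL] at h1
    exact hek_ne (L.injective (h1.trans (map_zero L).symm))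
  have hl₀ : k ≤ n + 1 := hkn
  set lN : Fin (n + 2) := ⟨n + 1, by omega⟩ with hlN
  set z₀ : 𝔼₂ := (3 : ℝ) • EuclideanSpace.single lN (1 : ℝ) with hz₀
  have hP0 : P z₀ = 1 := by
    have hU : IsOpen {z : 𝔼₂ | 2 < |z lN|} :=
      isOpen_lt continuous_const (continuous_abs.comp ((EuclideanSpace.proj (𝕜 := ℝ) lN :
        𝔼₂ →L[ℝ] ℝ).continuous))
    have hz₀U : z₀ ∈ {z : 𝔼₂ | 2 < |z lN|} := by
      show 2 < |z₀ lN|; simp [hz₀]; norm_num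
    have hev : θ =ᶠ[𝓝 z₀] fun _ => 0 := by
      filter_upwards [hU.mem_nhds hz₀U] with z hz
      have := hh_normal z ⟨lN, by simp [hlN]; omega, hz.le⟩
      simp [hθ, this]
    have : fderiv ℝ θ z₀ = 0 := by rw [hev.fderiv_eq]; simp
    simp [hP, this]
  have hPpos : ∀ z, 0 < P z := by
    intro z
    by_contra hneg
    have hle : P z ≤ 0 := not_lt.1 hneg
    obtain ⟨w, hw⟩ := mem_range_of_exists_le_of_exists_ge hPc ⟨z, hle⟩ ⟨z₀, by rw [hP0]; norm_num⟩
    exact hPne w hw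
  -- ### the sets
  set Ucol : Set 𝔼₂ := ⋃ i : Fin (n + 2), {z | i.val < k ∧ 1 - ρ / 4 < |z i|} with hUcol
  set U₁ : Set 𝔼₂ := ⋃ i : Fin (n + 2), {z | i.val < k ∧ 1 - ρ < |z i|} with hU₁
  have habs_cont : ∀ i : Fin (n + 2), Continuous fun z : 𝔼₂ => |z i| := fun i =>
    continuous_abs.comp ((EuclideanSpace.proj (𝕜 := ℝ) i : 𝔼₂ →L[ℝ] ℝ).continuous)
  have hopen_coord : ∀ (q : ℝ), IsOpen (⋃ i : Fin (n + 2), {z : 𝔼₂ | i.val < k ∧ q < |z i|}) := by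
    intro q
    refine isOpen_iUnion fun i => ?_
    by_cases hi : i.val < k
    · simpa [hi] using isOpen_lt continuous_const (habs_cont i)
    · simp [hi]
  have hUcol_open : IsOpen Ucol := hopen_coord _
  have hU₁_open : IsOpen U₁ := hopen_coord _
  set E : Set 𝔼₂ := (thickening (8 * r) (planeCube k QC ∩ collarPart k (1 - ρ))) ∩ Ucol with hE
  set Ω : Set 𝔼₂ := (W ∩ thickening r (planeCube k QC)) ∪ ((thickening (8 * r) (planeCube k QC ∩ collarPart k (1 - ρ))) ∩ U₁) with hΩ
  have hZT₈ : planeCube (m := n + 2) k QC ∩ collarPart k (1 - ρ) ⊆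
      thickening (8 * r) (planeCube k QC ∩ collarPart k (1 - ρ)) :=
    self_subset_thickening (by positivity) _
  -- ### the data
  refine ⟨H, E, Ω, g, ?_⟩
  exact
    { contDiff_H := fun s => contDiff_id.add ((hθs.smul contDiff_const).const_smul s)
      H_zero := fun y => by simp [hH]
      dist_le := fun s hs y => by
        rw [dist_eq_norm]
        simp only [hH, add_sub_cancel_left, norm_smul, Real.norm_eq_abs, hek_norm, mul_one,
          abs_of_nonneg hs.1]
        calc s * |θ y| ≤ 1 * |θ y| := by gcongr; exact hs.2
          _ ≤ δ := by rw [one_mul]; exact (hθabs y).trans hε₂δ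
      isInvertible := fun s hs y => by
        rw [(hHd s y).fderiv]
        refine isInvertible_id_add_smul_rankOne (fderiv ℝ θ y) ek ?_
        have h1 : 0 < P y := hPpos y
        refine ne_of_gt ?_
        have key : 1 + s * fderiv ℝ θ y ek = P y + (1 - P y) * (1 - s) := by
          simp only [hP]; ring
        rw [key]
        rcases le_or_gt (P y) 1 with hP1 | hP1
        · nlinarith [mul_nonneg (sub_nonneg.2 hP1) (sub_nonneg.2 hs.2)]
        · nlinarith [mul_nonneg hs.1 (le_of_lt (sub_pos.2 hP1)), hs.2]
      continuous_H := by
        show Continuous fun q : ℝ × 𝔼₂ => q.2 + q.1 • (θ q.2 • ek)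
        exact continuous_snd.add (continuous_fst.smul ((hθs.continuous.comp continuous_snd).smul
          continuous_const))
      continuous_fderiv := by
        have heq : (fun q : ℝ × 𝔼₂ => fderiv ℝ (H q.1) q.2) =
            fun q => ContinuousLinearMap.id ℝ 𝔼₂ + q.1 • R q.2 := by
          funext q; exact (hHd q.1 q.2).fderiv
        rw [heq]
        exact continuous_const.add (continuous_fst.smul (hRc.comp continuous_snd))
      isOpen_ends := hT₈open.inter hUcol_open
      boundary_subset := fun y hy => by
        refine ⟨hZT₈ ⟨hy.1, ?_⟩, ?_⟩
        · obtain ⟨i, hi, hyi⟩ := hy.2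
          exact ⟨i, hi, by linarith⟩
        · obtain ⟨i, hi, hyi⟩ := hy.2
          exact mem_iUnion.2 ⟨i, hi, by linarith⟩
      ends_subset := fun y hy => hT₈O hy.1
      H_eq_self := fun s y hy => by
        obtain ⟨i, hi, hyi⟩ := mem_iUnion.1 hy.2
        have h1 : h y = y := hh_collar y ⟨i, hi, hyi.le⟩
        have h2 : θ y = 0 := by simp [hθ, h1]
        simp [hH, h2]
      g_eq := fun y hy => by
        obtain ⟨i, hi, hyi⟩ := mem_iUnion.1 hy.2
        rw [hg_collar y ⟨i, hi, by linarith⟩, hfφ₀ y hy.1]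
      isOpen := (hW.inter isOpen_thickening).union (hT₈open.inter hU₁_open)
      image_subset := fun y hy => by
        have hHy : H 1 y = h y := by rw [hH1]
        rw [hHy]
        by_cases hsmall : ∀ i : Fin (n + 2), i.val < k → |y i| ≤ 1
        · refine Or.inl ⟨hKW y hsmall hy.2, ?_⟩
          rw [mem_thickening_iff]
          refine ⟨y, hy, ?_⟩
          rw [dist_eq_norm, hhθ y, add_sub_cancel_left, norm_smul, Real.norm_eq_abs,
            hek_norm, mul_one]
          linarith [hθabs y]
        · simp only [not_forall, not_le, exists_prop] at hsmall
          obtain ⟨i, hi, hyi⟩ := hsmall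
          have h1 : h y = y := hh_collar y ⟨i, hi, by linarith⟩
          rw [h1]
          refine Or.inr ⟨hZT₈ ⟨hy, i, hi, by linarith⟩, mem_iUnion.2 ⟨i, hi, by linarith⟩⟩
      contDiff_g := hg
      approx := fun y hy => by
        rcases hy with hy | hy
        · -- on the tube `W`, near the big cube
          have h1 := hgf y hy.1
          have h2 := hDgA y hy.1
          have h3 := hfF₀ y
          have h4 := hAF₁ y (thickening_subset_cthickening r _ hy.2)
          constructor
          · calc ‖g y - F₀ y‖ = ‖(g y - f y) + (f y - F₀ y)‖ := by congr 1; abel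
              _ ≤ ‖g y - f y‖ + ‖f y - F₀ y‖ := norm_add_le _ _
              _ < ε₂ + ε / 3 := by linarith
              _ ≤ ε := by linarith
          · calc ‖fderiv ℝ g y - F₁ y‖ = ‖(fderiv ℝ g y - A y) + (A y - F₁ y)‖ := by
                  congr 1; abel
              _ ≤ ‖fderiv ℝ g y - A y‖ + ‖A y - F₁ y‖ := norm_add_le _ _
              _ < ε₂ + ε / 3 := by linarith
              _ ≤ ε := by linarith
        · -- near the collar of the big cube: everything is exact
          have hyO : y ∈ O' := hT₈O hy.1
          have hgev : g =ᶠ[𝓝 y] f := by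
            filter_upwards [hU₁_open.mem_nhds hy.2] with z hz
            obtain ⟨i, hi, hzi⟩ := mem_iUnion.1 hz
            exact hg_collar z ⟨i, hi, hzi.le⟩
          have hfev : f =ᶠ[𝓝 y] φ₀ := by
            filter_upwards [hT₈open.mem_nhds hy.1] with z hz
            exact hfφ₀ z hz
          have h1 : g y = F₀ y := by
            rw [hgev.self_of_nhds, hfev.self_of_nhds, (hhol y hyO).1]
          have h2 : fderiv ℝ g y = F₁ y := by
            rw [hgev.fderiv_eq, hfev.fderiv_eq, (hhol y hyO).2]
          simp [h1, h2, hε] }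

end Literature.Topology.Immersions
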